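import Literature.NumberTheory.EllipticCurves.NodeReductionMapProofs
import Literature.NumberTheory.EllipticCurves.SingularCubicMapProofs
import Literature.NumberTheory.EllipticCurves.PointReduction
import HarnessLib

/-!
# The Galois behaviour of the reduction map onto the torus at a node: an isometric
# automorphism acts on `r = ψ ∘ (reduction)` through the residue field, equivariantly at a split
# node and anti-equivariantly at a non-split node (Silverman *AEC* Exercise 3.5(a))

Sibling proof file (theorems only) of `NodeReductionMapProofs` (the reduction map
`r : E₀(L) → kˣ` at a presented node `W̃₀ = singularModel x₀ y₀ α₁ α₂`, with its formula
`r(a, b) = ψ(ā, b̄)`), `SingularCubicMapProofs` (`ψ` under ring homomorphisms) and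
`ReductionInertiaInvarianceProofs` (the setting: a Weierstrass equation `X` over a subfield
`F₀ ⊆ L` with `X_L = (W₀)_L` for an `𝒪_w`-equation `W₀`, and an `F₀`-endomorphism `σ` of `L`
which is a `w`-isometry; there `σ` in the *inertia* group was shown to act trivially on
reductions).  Here `σ` is any isometry (an element of the *decomposition* group, Neukirch *ANT*
II §9) and we compute its effect on `r`:

* `WeierstrassCurve.exists_residueMap_nodeReduction_smul`: `σ` induces an endomorphism `σ̄` of
  the residue field `k` of `𝒪_w` with `σ̄ ā = \overline{σ a}`; `E₀` is `σ`-stable; `σ̄` fixes the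
  singular point of `W̃₀`; and **either `σ̄` fixes both tangent slopes and `r(P^σ) = σ̄(r P)` for
  all `P ∈ E₀` (the split node), or `σ̄` swaps them and `r(P^σ) = σ̄(r P)⁻¹` (the non-split
  node)** — Silverman, *AEC*, Exercise 3.5(a): `E_ns(k) ≅ k^*` when the slopes are rational,
  `≅ {t : N(t) = 1}` otherwise, i.e. the Galois group acts on `ψ` through inversion.

Mechanism: the coefficients of `W₀` are those of `X`, in `F₀`, so `σ` fixes them and `σ̄` fixes
`W̃₀`; an endomorphism fixing a singular model fixes its unique singular point and permutes the
roots of its tangent cone (`singularModel.apply_eq_of_map_eq`); on an integral point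
`r(σ a, σ b) = ψ(σ̄ ā, σ̄ b̄)`, which is `σ̄ ψ(ā, b̄)` or its inverse according to the case
(`nodeFun_map_some`, `nodeFun_swap_some`); on `E₁` both sides are `1` (`σ` is an isometry).
This is the (anti-)equivariance input `hr` of the reduction data of
`HasseWeilAbelianEulerFactorTorsionProofs` (torsion-point forms of Serre–Tate's Lemma 2 at the
multiplicative places), for `σ` a local Frobenius.

## References

* J. H. Silverman, *The Arithmetic of Elliptic Curves*, 2nd ed. (2009), Exercise 3.5(a) (PDF
  p. 97), VII.§5 (split and non-split multiplicative reduction, PDF p. 174), VII.2.1.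
  [SilvermanAEC2009]
* J. Neukirch, *Algebraic Number Theory* (1999), Ch. II §9 (decomposition group and residue
  field automorphisms). [NeukirchANT1999]

## Design

Theorems only; `open scoped Classical NNReal`; the setting and hypotheses `hX`, `hσ₁` of
`ReductionInertiaInvarianceProofs` §Transport; `r` enters through its two properties from
`NodeReductionMapProofs` (kernel, formula), so any such map qualifies; the residue endomorphism
is produced existentially with its defining property (it is `IsLocalRing.ResidueField.map` of the
restriction of `σ` to `𝒪_w`, a local homomorphism because `σ` is an isometry).
-/

noncomputable section

open scoped Classical NNReal

universe u

namespace WeierstrassCurve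

open Literature.NumberTheory.EllipticCurves

variable {L : Type u} [Field L] {w : Valuation L ℝ≥0} (W₀ : WeierstrassCurve w.integer)
  {F₀ : Type*} [Field F₀] [Algebra F₀ L] {X : WeierstrassCurve F₀}
  (hX : X.baseChange L = W₀.baseChange L) (σ : L →ₐ[F₀] L) (hσ₁ : ∀ z, w (σ z) = w z)

include hσ₁ in
/-- **An isometric automorphism acts on `r = ψ ∘ reduction` through the residue field,
equivariantly or anti-equivariantly.**  Let `X` be a Weierstrass equation over a subfield
`F₀ ⊆ L`, `W₀` an `𝒪_w`-equation with `X_L = (W₀)_L` whose reduction is a presented node,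
`W̃₀ = singularModel x₀ y₀ α₁ α₂` over the residue field `k` of `𝒪_w` (a node when `α₁ ≠ α₂`,
which is not needed here),
`r : E₀(L) → kˣ` the reduction map onto the torus (`NodeReductionMapProofs`: kernel `E₁`, formula
`r(a, b) = ψ(ā, b̄)`), and `σ` an `F₀`-automorphism of `L` which is a `w`-isometry (the elements of
a decomposition group; Neukirch *ANT* II §9).  Then `σ` induces an endomorphism `σ̄` of `k`
(`σ̄ ā = \overline{σ a}`), `E₀` is `σ`-stable, and **either `σ̄` fixes both tangent slopes and
`r(P^σ) = σ̄ (r P)` on `E₀` (split node), or `σ̄` swaps the slopes and `r(P^σ) = σ̄ (r P)⁻¹`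
(non-split node)** — because `σ̄` fixes the reduced equation (its coefficients come from `F₀`),
hence fixes its unique singular point and permutes the roots of its tangent cone
(`singularModel.apply_eq_of_map_eq`), and `ψ` commutes with `σ̄` up to this relabelling of the
slopes (`singularModel.nodeFun_map_some`, `nodeFun_swap_some`).  Silverman, *AEC*, Exercise
3.5(a) (i) split: `E_ns(k) ≅ k^*`; (ii) non-split: `E_ns(k) ≅ {N = 1} ⊆ k(α₁)^*`, i.e. the
Galois group acts on `ψ` by inversion; VII.§5 (split / non-split multiplicative reduction).
[cite: SilvermanAEC2009, Exercise 3.5(a) and VII.§5 (PDF pp. 97, 174)] -/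
theorem exists_residueMap_nodeReduction_smul {x₀ y₀ α₁ α₂ : IsLocalRing.ResidueField w.integer}
    (hW : W₀.map (IsLocalRing.residue w.integer) = singularModel x₀ y₀ α₁ α₂)
    (r : W₀.nonsingularReductionSubgroup (Valuation.integer.integers w) →+
      Additive (IsLocalRing.ResidueField w.integer)ˣ)
    (hr0 : ∀ P : W₀.nonsingularReductionSubgroup (Valuation.integer.integers w),
      r P = 0 ↔ W₀.ReducesToZero (P : (W₀.baseChange L).toAffine.Point))
    (hr : ∀ (a b : w.integer)
      (h : (W₀.baseChange L).toAffine.Nonsingular (algebraMap w.integer L a) (algebraMap w.integer L b))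
      (hns : (singularModel x₀ y₀ α₁ α₂).toAffine.Nonsingular (IsLocalRing.residue w.integer a)
        (IsLocalRing.residue w.integer b))
      (hP : W₀.HasNonsingularReduction (.some _ _ h)),
      ((r ⟨.some _ _ h, hP⟩).toMul : IsLocalRing.ResidueField w.integer) =
        singularModel.nodeFun x₀ y₀ α₁ α₂ (.some _ _ hns)) :
    ∃ σk : IsLocalRing.ResidueField w.integer →+* IsLocalRing.ResidueField w.integer,
      (∀ (a : L) (ha : w a ≤ 1) (hσa : w (σ a) ≤ 1),
        σk (IsLocalRing.residue w.integer ⟨a, ha⟩) = IsLocalRing.residue w.integer ⟨σ a, hσa⟩) ∧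
      (∀ P : (X.baseChange L).toAffine.Point,
        W₀.HasNonsingularReduction (Affine.Point.congrEquiv hX P) →
          W₀.HasNonsingularReduction (Affine.Point.congrEquiv hX (Affine.Point.map σ P))) ∧
      σk x₀ = x₀ ∧ σk y₀ = y₀ ∧
      ((σk α₁ = α₁ ∧ σk α₂ = α₂ ∧
        ∀ (P : (X.baseChange L).toAffine.Point)
          (hP : W₀.HasNonsingularReduction (Affine.Point.congrEquiv hX P))
          (hσP : W₀.HasNonsingularReduction (Affine.Point.congrEquiv hX (Affine.Point.map σ P))),
          ((r ⟨_, hσP⟩).toMul : IsLocalRing.ResidueField w.integer) =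
            σk ((r ⟨_, hP⟩).toMul : IsLocalRing.ResidueField w.integer)) ∨
       (σk α₁ = α₂ ∧ σk α₂ = α₁ ∧
        ∀ (P : (X.baseChange L).toAffine.Point)
          (hP : W₀.HasNonsingularReduction (Affine.Point.congrEquiv hX P))
          (hσP : W₀.HasNonsingularReduction (Affine.Point.congrEquiv hX (Affine.Point.map σ P))),
          ((r ⟨_, hσP⟩).toMul : IsLocalRing.ResidueField w.integer) =
            (σk ((r ⟨_, hP⟩).toMul : IsLocalRing.ResidueField w.integer))⁻¹)) := by
  have hv : w.Integers w.integer := Valuation.integer.integers w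
  -- `σ` restricted to `𝒪_w`, a local homomorphism, and the induced map of residue fields
  let σR : w.integer →+* w.integer :=
    { toFun := fun a ↦ ⟨σ a, by rw [Valuation.mem_integer_iff, hσ₁]; exact a.2⟩
      map_one' := Subtype.ext (by simp)
      map_mul' := fun a b ↦ Subtype.ext (by simp)
      map_zero' := Subtype.ext (by simp)
      map_add' := fun a b ↦ Subtype.ext (by simp) }
  have hσR : ∀ a : w.integer, (σR a : L) = σ a := fun _ ↦ rfl
  haveI : IsLocalHom σR := by
    refine ⟨fun a ha ↦ ?_⟩
    rw [hv.isUnit_iff_valuation_eq_one] at ha ⊢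
    rw [← ha]
    exact (hσ₁ a).symm
  let σk : IsLocalRing.ResidueField w.integer →+* IsLocalRing.ResidueField w.integer :=
    IsLocalRing.ResidueField.map σR
  have hσk : ∀ a : w.integer, σk (IsLocalRing.residue w.integer a) =
      IsLocalRing.residue w.integer (σR a) := fun a ↦ IsLocalRing.ResidueField.map_residue σR a
  -- `σ` fixes the coefficients of `W₀` (they come from `F₀`), so `σ̄` fixes the reduction
  have hcoefL : ∀ {c : w.integer} {x : F₀}, algebraMap F₀ L x = (c : L) → σ c = c := by
    intro c x hcx
    rw [← hcx, AlgHom.commutes]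
  have hWσ : W₀.map σR = W₀ := by
    have h1 := congrArg WeierstrassCurve.a₁ hX
    have h2 := congrArg WeierstrassCurve.a₂ hX
    have h3 := congrArg WeierstrassCurve.a₃ hX
    have h4 := congrArg WeierstrassCurve.a₄ hX
    have h6 := congrArg WeierstrassCurve.a₆ hX
    simp only [baseChange, map_a₁, map_a₂, map_a₃, map_a₄, map_a₆] at h1 h2 h3 h4 h6
    ext
    · change σ (W₀.a₁ : L) = W₀.a₁; exact hcoefL h1
    · change σ (W₀.a₂ : L) = W₀.a₂; exact hcoefL h2
    · change σ (W₀.a₃ : L) = W₀.a₃; exact hcoefL h3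
    · change σ (W₀.a₄ : L) = W₀.a₄; exact hcoefL h4
    · change σ (W₀.a₆ : L) = W₀.a₆; exact hcoefL h6
  have hWk : (singularModel x₀ y₀ α₁ α₂).map σk = singularModel x₀ y₀ α₁ α₂ := by
    rw [← hW, map_map]
    change W₀.map ((IsLocalRing.ResidueField.map σR).comp (IsLocalRing.residue w.integer)) = _
    rw [IsLocalRing.ResidueField.map_comp_residue, ← map_map, hWσ]
  obtain ⟨hx₀, hy₀, hslopes⟩ := singularModel.apply_eq_of_map_eq hWk
  -- residues of `σ`-moved integers
  have hσres : ∀ (a : L) (ha : w a ≤ 1) (hσa : w (σ a) ≤ 1),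
      σk (IsLocalRing.residue w.integer ⟨a, ha⟩) = IsLocalRing.residue w.integer ⟨σ a, hσa⟩ := by
    intro a ha hσa
    rw [hσk]
    exact congrArg _ (Subtype.ext rfl)
  -- the moved point, on coordinates
  have hmove : ∀ {x y : L} (h : (X.baseChange L).toAffine.Nonsingular x y),
      ∃ h' : (W₀.baseChange L).toAffine.Nonsingular (σ x) (σ y),
        Affine.Point.congrEquiv hX (Affine.Point.map σ (.some x y h)) = .some _ _ h' := by
    intro x y h
    rw [Affine.Point.map_some, Affine.Point.congrEquiv_some]
    exact ⟨_, rfl⟩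
  have hfix : ∀ {x y : L} (h : (X.baseChange L).toAffine.Nonsingular x y),
      ∃ h' : (W₀.baseChange L).toAffine.Nonsingular x y,
        Affine.Point.congrEquiv hX (.some x y h) = .some _ _ h' := by
    intro x y h
    rw [Affine.Point.congrEquiv_some]
    exact ⟨_, rfl⟩
  -- integral points: reduction of `(a, b)` and of `(σ a, σ b)`
  have hns_iff : ∀ {a b : w.integer}
      (h : (W₀.baseChange L).toAffine.Nonsingular (algebraMap w.integer L a)
        (algebraMap w.integer L b)),
      W₀.HasNonsingularReduction (.some _ _ h) ↔
        (singularModel x₀ y₀ α₁ α₂).toAffine.Nonsingular (IsLocalRing.residue w.integer a)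
          (IsLocalRing.residue w.integer b) := by
    intro a b h
    rw [hasNonsingularReduction_some_algebraMap_iff hv.hom_inj h, hW]
  -- `E₀` is `σ`-stable
  have hstable : ∀ P : (X.baseChange L).toAffine.Point,
      W₀.HasNonsingularReduction (Affine.Point.congrEquiv hX P) →
        W₀.HasNonsingularReduction (Affine.Point.congrEquiv hX (Affine.Point.map σ P)) := by
    intro P hP
    rcases P with _ | ⟨x, y, h⟩
    · rw [← Affine.Point.zero_def, map_zero, map_zero]; trivial
    · obtain ⟨h', hh'⟩ := hmove h
      obtain ⟨h₀, hh₀⟩ := hfix h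
      rw [hh']
      rw [hh₀] at hP
      by_cases hx : w x ≤ 1
      · have hy : w y ≤ 1 := v_Y_le_one_of_v_X_le_one hv h₀.1 hx
        have hσx : w (σ x) ≤ 1 := by rw [hσ₁]; exact hx
        have hσy : w (σ y) ≤ 1 := by rw [hσ₁]; exact hy
        have h₀' : (W₀.baseChange L).toAffine.Nonsingular (algebraMap w.integer L ⟨x, hx⟩)
            (algebraMap w.integer L ⟨y, hy⟩) := h₀
        have hP' : W₀.HasNonsingularReduction (.some _ _ h₀') := hP
        have hns := (hns_iff h₀').mp hP'
        have hσns := singularModel.nonsingular_map σk hns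
        rw [hx₀, hy₀, hσk, hσk] at hσns
        have : W₀.HasNonsingularReduction (.some (algebraMap w.integer L (σR ⟨x, hx⟩))
            (algebraMap w.integer L (σR ⟨y, hy⟩)) h') := by
          rw [hns_iff h']
          rcases hslopes with ⟨h₁, h₂⟩ | ⟨h₁, h₂⟩
          · rw [h₁, h₂] at hσns; exact hσns
          · rw [h₁, h₂] at hσns; exact singularModel.nonsingular_swap hσns
        exact this
      · have hx1 : 1 < w x := not_le.mp hx
        left
        rw [not_mem_range_iff hv, hσ₁]
        exact hx1
  refine ⟨σk, hσres, hstable, hx₀, hy₀, ?_⟩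
  -- `r = 1` on `E₁`
  have hone : ∀ (Q : (W₀.baseChange L).toAffine.Point) (hQ : W₀.HasNonsingularReduction Q),
      W₀.ReducesToZero Q → ((r ⟨Q, hQ⟩).toMul : IsLocalRing.ResidueField w.integer) = 1 := by
    intro Q hQ h0
    have := (hr0 ⟨Q, hQ⟩).mpr h0
    rw [this, toMul_zero, Units.val_one]
  -- the value of `r` on a moved point (points generalized, so that `subst` applies)
  have key : ∀ (Q Qσ : (W₀.baseChange L).toAffine.Point) (hQ : W₀.HasNonsingularReduction Q)
      (hQσ : W₀.HasNonsingularReduction Qσ) (P : (X.baseChange L).toAffine.Point),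
      Affine.Point.congrEquiv hX P = Q →
      Affine.Point.congrEquiv hX (Affine.Point.map σ P) = Qσ →
      ((σk α₁ = α₁ ∧ σk α₂ = α₂) →
        ((r ⟨Qσ, hQσ⟩).toMul : IsLocalRing.ResidueField w.integer) =
          σk ((r ⟨Q, hQ⟩).toMul : IsLocalRing.ResidueField w.integer)) ∧
      ((σk α₁ = α₂ ∧ σk α₂ = α₁) →
        ((r ⟨Qσ, hQσ⟩).toMul : IsLocalRing.ResidueField w.integer) =
          (σk ((r ⟨Q, hQ⟩).toMul : IsLocalRing.ResidueField w.integer))⁻¹) := by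
    intro Q Qσ hQ hQσ P hPQ hPQσ
    rcases P with _ | ⟨x, y, h⟩
    · -- `P = O`: both sides are `1`
      have hQ0 : Q = 0 := by rw [← hPQ, ← Affine.Point.zero_def, map_zero]
      have hQσ0 : Qσ = 0 := by rw [← hPQσ, ← Affine.Point.zero_def, map_zero, map_zero]
      subst hQ0
      subst hQσ0
      rw [hone 0 hQσ reducesToZero_zero, map_one, inv_one]
      exact ⟨fun _ ↦ rfl, fun _ ↦ rfl⟩
    · obtain ⟨h', hh'⟩ := hmove h
      obtain ⟨h₀, hh₀⟩ := hfix h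
      rw [hh₀] at hPQ
      rw [hh'] at hPQσ
      subst hPQ
      subst hPQσ
      by_cases hx : w x ≤ 1
      · -- integral point: `r (a, b) = ψ(ā, b̄)`, `r (σ a, σ b) = ψ(σ̄ ā, σ̄ b̄)`
        have hy : w y ≤ 1 := v_Y_le_one_of_v_X_le_one hv h₀.1 hx
        have h₀' : (W₀.baseChange L).toAffine.Nonsingular (algebraMap w.integer L ⟨x, hx⟩)
            (algebraMap w.integer L ⟨y, hy⟩) := h₀
        have h'' : (W₀.baseChange L).toAffine.Nonsingular (algebraMap w.integer L (σR ⟨x, hx⟩))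
            (algebraMap w.integer L (σR ⟨y, hy⟩)) := h'
        have hQ' : W₀.HasNonsingularReduction (.some _ _ h₀') := hQ
        have hQσ' : W₀.HasNonsingularReduction (.some _ _ h'') := hQσ
        have hns := (hns_iff h₀').mp hQ'
        have hσns' := singularModel.nonsingular_map σk hns
        rw [hx₀, hy₀, hσk, hσk] at hσns'
        have hrP : ((r ⟨.some _ _ h₀', hQ'⟩).toMul : IsLocalRing.ResidueField w.integer) =
            singularModel.nodeFun x₀ y₀ α₁ α₂ (.some _ _ hns) := hr ⟨x, hx⟩ ⟨y, hy⟩ h₀' hns hQ'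
        have eQ : (⟨.some x y h₀, hQ⟩ : W₀.nonsingularReductionSubgroup hv) = ⟨.some _ _ h₀', hQ'⟩ :=
          rfl
        have eQσ : (⟨.some (σ x) (σ y) h', hQσ⟩ : W₀.nonsingularReductionSubgroup hv) =
            ⟨.some _ _ h'', hQσ'⟩ := rfl
        rw [eQ, eQσ, hrP]
        constructor
        · rintro ⟨h₁, h₂⟩
          have hσns : (singularModel x₀ y₀ α₁ α₂).toAffine.Nonsingular
              (IsLocalRing.residue w.integer (σR ⟨x, hx⟩))
              (IsLocalRing.residue w.integer (σR ⟨y, hy⟩)) := by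
            rw [h₁, h₂] at hσns'; exact hσns'
          rw [hr (σR ⟨x, hx⟩) (σR ⟨y, hy⟩) h'' hσns hQσ']
          simp only [singularModel.nodeFun, map_div₀, map_sub, map_mul, hσk, hx₀, hy₀, h₁, h₂]
        · rintro ⟨h₁, h₂⟩
          have hσns : (singularModel x₀ y₀ α₁ α₂).toAffine.Nonsingular
              (IsLocalRing.residue w.integer (σR ⟨x, hx⟩))
              (IsLocalRing.residue w.integer (σR ⟨y, hy⟩)) := by
            rw [h₁, h₂] at hσns'
            exact singularModel.nonsingular_swap (α₁ := α₂) (α₂ := α₁) hσns'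
          rw [hr (σR ⟨x, hx⟩) (σR ⟨y, hy⟩) h'' hσns hQσ']
          simp only [singularModel.nodeFun, map_div₀, map_sub, map_mul, hσk, hx₀, hy₀, h₁, h₂,
            inv_div]
      · -- a point of `E₁`: both sides are `1`
        have hx1 : 1 < w x := not_le.mp hx
        have h0P : W₀.ReducesToZero (.some x y h₀) :=
          (reducesToZero_some_iff h₀).mpr ((not_mem_range_iff hv).mpr hx1)
        have h0σ : W₀.ReducesToZero (.some (σ x) (σ y) h') :=
          (reducesToZero_some_iff h').mpr ((not_mem_range_iff hv).mpr (by rw [hσ₁]; exact hx1))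
        rw [hone _ hQσ h0σ, hone _ hQ h0P, map_one, inv_one]
        exact ⟨fun _ ↦ rfl, fun _ ↦ rfl⟩
  rcases hslopes with ⟨h₁, h₂⟩ | ⟨h₁, h₂⟩
  · exact Or.inl ⟨h₁, h₂, fun P hP hσP ↦ (key _ _ hP hσP P rfl rfl).1 ⟨h₁, h₂⟩⟩
  · exact Or.inr ⟨h₁, h₂, fun P hP hσP ↦ (key _ _ hP hσP P rfl rfl).2 ⟨h₁, h₂⟩⟩

end WeierstrassCurve

end
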